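import Summits.QuantumAdvantage.QuantumAdvantage.Theses.ArithStatLadder
import Literature.Computability.Cryptography.HallgrenClassGroup
import Literature.Computability.Cryptography.ClassBQPProofs
import Literature.Computability.QuantumComplexity.BQPContainmentsProofs

/-!
# `IqThreeMemBQP` (stmt-QuantumAdvantage-2424) — small models and the cost of a refutation

Negative-side lemmas for the crux `ArithStatLadder.IqThreeMemBQP` (`IQ3 ∈ BQP`, IQ3 = binary codes of
the `d` with `−d` a fundamental discriminant and `3 ∣ h(−d)`), extracted from the refuter work file
`Summits/QuantumAdvantage/QuantumAdvantage/Cruxes/IqThreeMemBQP/Disproof.lean`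
(refuter-cdisprove-stmt-QuantumAdvantage-2424-0, cycle 1) so that planners and provers can import
them. Sorry-free; axioms ⊆ {propext, Classical.choice, Quot.sound}.

* READING: the crux is literally `toLanguage {d | IsNegFundamentalDiscr d ∧ 3 ∣ h(−d)} ∈ BQP`
  (`iqThreeMemBQP_iff`, `Iff.rfl`: `IsNegFundamentalDiscr` of `HallgrenClassGroup.lean` is verbatim
  the route file's inline disjunction).
* SMALL MODELS: `h(−23) = 3` (by `decide` on the tree's reduced-form enumeration; `h(−3) = h(−4) = 1`
  are `Literature.NumberTheory.QuadraticFields.Quadratic.classNumber_neg_three/_four`, re-decided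
  inline here to keep the imports light); `23 ∈ S`, `0, 3, 4 ∉ S`; the empty word is outside the language; the language is
  neither `∅` nor `{0,1}*` — so the item is not closed by a trivial-language shortcut.
* COST OF A REFUTATION (why the crux resists every cheap attack): from `¬ IqThreeMemBQP` follow
  `IQ3 ∉ BPP` and `IQ3 ∉ P` outright (tree theorems `BPP_subset_BQP_holds`, `P_subset_BQP_holds`),
  and `BQP ≠ PSPACE`, `P ≠ PSPACE` as soon as the folklore `IQ3 ∈ PSPACE` (a polynomial-space
  reduced-form counter) is supplied. An unconditional refutation would thus be a super-polynomial
  uniform lower bound for an explicit `PSPACE` language against quantum polynomial time — beyond the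
  state of the art (cf. `Literature.Barriers.QuantumAdvantage.SeparationPrerequisites`, the same
  phenomenon for the summit). (Dually, `P = PSPACE` together with `IQ3 ∈ PSPACE` implies the crux;
  that conditional positive form stays in the work file.)
-/

noncomputable section

namespace Summit.QuantumAdvantage.QuantumAdvantage.Theorems.IqThreeMemBQP.Negative

open _root_.Computability Literature.Computability.Complexity Literature.Computability.Complexity.Classes
open Literature.Computability.Cryptography Literature.Computability.QuantumComplexity
open Literature.NumberTheory.QuadraticFields
open Summit.QuantumAdvantage.QuantumAdvantage.Theses.ArithStatLadder (IqThreeMemBQP)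

/-! ### Reading -/

/-- The crux is literally membership of `bin {d | IsNegFundamentalDiscr d ∧ 3 ∣ h(−d)}` in `BQP`
(definitional unfolding). [folklore] -/
theorem iqThreeMemBQP_iff : IqThreeMemBQP ↔
    encodingNatBool.toLanguage
      {d : ℕ | IsNegFundamentalDiscr d ∧ 3 ∣ BinaryQuadraticForm.classNumber (-(d : ℤ))} ∈ BQP :=
  Iff.rfl

/-! ### Small models -/

/-- `h(−23) = 3` (the least fundamental discriminant with `3 ∣ h`). [folklore] -/
theorem classNumber_neg_twentythree : BinaryQuadraticForm.classNumber (-23) = 3 := by decide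

/-- `0 ∉ S`: `0` is not a fundamental discriminant. [folklore] -/
theorem zero_not_mem :
    (0 : ℕ) ∉ {d : ℕ | IsNegFundamentalDiscr d ∧ 3 ∣ BinaryQuadraticForm.classNumber (-(d : ℤ))} := by
  rintro ⟨h, -⟩
  rcases h with ⟨h1, -, -⟩ | ⟨-, h2, -⟩
  · norm_num at h1
  · norm_num at h2

/-- `3 ∉ S`: `−3` is fundamental but `h(−3) = 1`. [folklore] -/
theorem three_not_mem :
    (3 : ℕ) ∉ {d : ℕ | IsNegFundamentalDiscr d ∧ 3 ∣ BinaryQuadraticForm.classNumber (-(d : ℤ))} := by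
  rintro ⟨-, h⟩
  have h3 : BinaryQuadraticForm.classNumber (-3) = 1 := by decide
  rw [show (-(((3 : ℕ)) : ℤ)) = -3 by norm_num, h3] at h
  omega

/-- `4 ∉ S`: `−4` is fundamental but `h(−4) = 1`. [folklore] -/
theorem four_not_mem :
    (4 : ℕ) ∉ {d : ℕ | IsNegFundamentalDiscr d ∧ 3 ∣ BinaryQuadraticForm.classNumber (-(d : ℤ))} := by
  rintro ⟨-, h⟩
  have h4 : BinaryQuadraticForm.classNumber (-4) = 1 := by decide
  rw [show (-(((4 : ℕ)) : ℤ)) = -4 by norm_num, h4] at h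
  omega

/-- `23 ∈ S`: `−23 ≡ 1 (mod 4)` is squarefree (prime) and `h(−23) = 3`. [folklore] -/
theorem twentythree_mem :
    (23 : ℕ) ∈ {d : ℕ | IsNegFundamentalDiscr d ∧ 3 ∣ BinaryQuadraticForm.classNumber (-(d : ℤ))} := by
  refine ⟨Or.inl ⟨by decide, ?_, by decide⟩, ?_⟩
  · have h23 : Prime (-23 : ℤ) := Int.prime_iff_natAbs_prime.2 (by norm_num)
    exact_mod_cast h23.squarefree
  · rw [show (-(((23 : ℕ)) : ℤ)) = -23 by norm_num, classNumber_neg_twentythree]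

/-- The empty word is not in `IQ3` (it is `encodeNat 0`); at input length `0` the deciding family
must reject, which the tree's junk value `acceptProb = 0` on the empty register does. [folklore] -/
theorem nil_not_mem : ([] : List Bool) ∉ encodingNatBool.toLanguage
    {d : ℕ | IsNegFundamentalDiscr d ∧ 3 ∣ BinaryQuadraticForm.classNumber (-(d : ℤ))} := by
  rintro ⟨d, hd, hd0⟩
  change encodeNat d = [] at hd0
  have h := congrArg decodeNat hd0
  rw [decode_encodeNat] at h
  have h0 : d = 0 := h.trans (by decide)
  subst h0
  exact zero_not_mem hd

/-- `IQ3 ≠ ∅` (Mathlib's `Language` has `0 = ∅`): it contains `bin 23`. [folklore] -/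
theorem lang_ne_zero : encodingNatBool.toLanguage
    {d : ℕ | IsNegFundamentalDiscr d ∧ 3 ∣ BinaryQuadraticForm.classNumber (-(d : ℤ))} ≠ 0 := by
  intro h
  have h23 := (encodingNatBool.mem_toLanguage_iff _ 23).2 twentythree_mem
  rw [h] at h23
  exact h23

/-- `IQ3 ≠ {0,1}*`: it misses `bin 3`. [folklore] -/
theorem lang_ne_univ : encodingNatBool.toLanguage
    {d : ℕ | IsNegFundamentalDiscr d ∧ 3 ∣ BinaryQuadraticForm.classNumber (-(d : ℤ))} ≠
      (Set.univ : Set (List Bool)) := by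
  intro h
  have h3 : encodingNatBool.encode 3 ∉ encodingNatBool.toLanguage
      {d : ℕ | IsNegFundamentalDiscr d ∧ 3 ∣ BinaryQuadraticForm.classNumber (-(d : ℤ))} :=
    fun hm => three_not_mem ((encodingNatBool.mem_toLanguage_iff _ 3).1 hm)
  rw [h] at h3
  exact h3 (Set.mem_univ _)

/-! ### The cost of a refutation -/

/-- A refutation of the crux puts `IQ3` outside `BPP` (tree theorem `BPP ⊆ BQP`). [folklore] -/
theorem not_mem_BPP_of_not_iqThreeMemBQP (h : ¬ IqThreeMemBQP) :
    encodingNatBool.toLanguage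
      {d : ℕ | IsNegFundamentalDiscr d ∧ 3 ∣ BinaryQuadraticForm.classNumber (-(d : ℤ))} ∉ BPP :=
  fun hB => h (BPP_subset_BQP_holds hB)

/-- A refutation of the crux puts `IQ3` outside `P` (tree theorem `P ⊆ BQP`). [folklore] -/
theorem not_mem_P_of_not_iqThreeMemBQP (h : ¬ IqThreeMemBQP) :
    encodingNatBool.toLanguage
      {d : ℕ | IsNegFundamentalDiscr d ∧ 3 ∣ BinaryQuadraticForm.classNumber (-(d : ℤ))} ∉ P :=
  fun hP => h (P_subset_BQP_holds hP)

/-- A refutation of the crux, with the folklore `IQ3 ∈ PSPACE`, separates `BQP` from `PSPACE`.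
[folklore] -/
theorem BQP_ne_PSPACE_of_not_iqThreeMemBQP (h : ¬ IqThreeMemBQP)
    (hS : encodingNatBool.toLanguage
      {d : ℕ | IsNegFundamentalDiscr d ∧ 3 ∣ BinaryQuadraticForm.classNumber (-(d : ℤ))} ∈ PSPACE) :
    BQP ≠ PSPACE :=
  fun hEq => h (iqThreeMemBQP_iff.2 (hEq ▸ hS))

/-- … and `P` from `PSPACE` (tree theorem `P ⊆ BQP`). [folklore] -/
theorem P_ne_PSPACE_of_not_iqThreeMemBQP (h : ¬ IqThreeMemBQP)
    (hS : encodingNatBool.toLanguage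
      {d : ℕ | IsNegFundamentalDiscr d ∧ 3 ∣ BinaryQuadraticForm.classNumber (-(d : ℤ))} ∈ PSPACE) :
    P ≠ PSPACE :=
  fun hEq => not_mem_P_of_not_iqThreeMemBQP h (hEq ▸ hS)

end Summit.QuantumAdvantage.QuantumAdvantage.Theorems.IqThreeMemBQP.Negative

end
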